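import Mathlib
import Summits.Ventures.PercRepro.TriangleCapRowTArith

/-!
# PercRepro — THE ROW `a = 4` AT `r = 4 + j`: the deletion-read arithmetic against the one-triangle target
`2k − 14 + 2j` (p3, gen 49; part 205c)

The lemmas of part 203b at `a = 4` (their hypothesis `5 ≤ a` replaced by the literal `4`): the `T` cell `(k − 1, 4, 2)`
(`rowT_del_T_four`, slack `2`), the `B2` cell `(k − 1, 4, 3)` (`rowT_del_B_four`, slack `6 − 2d`), the rows
`r′ = 4 + j′` (`rowT_del_up_T_four`, slack `2uv + 6v + 2`), the all-off read (`rowT_alloff_arith_four`) and the crude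
mixed read at `d = 2` (`rowT_mixed_two_four`). Axioms: standard.
-/

namespace PercRepro

namespace TriangleCap

namespace C047

/-- `d + j + 2 = 4`: `D − z` on the `T` cell `(k − 1, 4, 2)`. -/
theorem rowT_del_T_four (j d k m' S' T : ℕ) (hs : d + j + 2 = 4) (hk : 12 + j ≤ k)
    (hmd : m' + d + (4 + j) = 4 * (k - 4))
    (hgap : S' + (4 - 2) * (k - 1 - 1 - (4 - 2)) + 2 * (k - 1 - 2 * 4 - 1) ≤ m' * (k - 1))
    (hT : T ≤ d * (k - 4 - 2)) :
    S' + 2 * T + d + d * d + (4 + j) * (k - 1 - (4 + j)) + (2 * k - 14 + 2 * j * (4 - 3)) ≤ (m' + d) * k := by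
  have h2 : 1 ≤ k := by omega
  have h3 : 1 ≤ k - 1 := by omega
  have h4 : 4 - 2 ≤ k - 1 - 1 := by omega
  have h5 : 2 * 4 ≤ k - 1 := by omega
  have h6 : 1 ≤ k - 1 - 2 * 4 := by omega
  have h7 : 4 ≤ k := by omega
  have h8 : 2 ≤ k - 4 := by omega
  have h9 : 4 + j ≤ k - 1 := by omega
  have h10 : 14 ≤ 2 * k := by omega
  zify [h2, h3, h4, h5, h6, h7, h8, h9, h10] at hgap hT hmd ⊢
  nlinarith [hgap, hT, hmd]

/-- `d + j + 1 = 4` (so `d ≤ 3`): `D − z` on the `B2` cell `(k − 1, 4, 3)`. -/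
theorem rowT_del_B_four (j d k m' S' T : ℕ) (hs : d + j + 1 = 4) (hk : 12 + j ≤ k)
    (hmd : m' + d + (4 + j) = 4 * (k - 4))
    (hgap : S' + (4 - 1) * (k - 1 - 1 - (4 - 1)) + 2 * (k - 1 - 2 * 4 - 1) ≤ m' * (k - 1))
    (hT : T ≤ d * (k - 4 - 2)) :
    S' + 2 * T + d + d * d + (4 + j) * (k - 1 - (4 + j)) + (2 * k - 14 + 2 * j * (4 - 3)) ≤ (m' + d) * k := by
  have hd3 : d ≤ 3 := by omega
  have h2 : 1 ≤ k := by omega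
  have h3 : 1 ≤ k - 1 := by omega
  have h4 : 4 - 1 ≤ k - 1 - 1 := by omega
  have h5 : 2 * 4 ≤ k - 1 := by omega
  have h6 : 1 ≤ k - 1 - 2 * 4 := by omega
  have h7 : 4 ≤ k := by omega
  have h8 : 2 ≤ k - 4 := by omega
  have h9 : 4 + j ≤ k - 1 := by omega
  have h10 : 14 ≤ 2 * k := by omega
  zify [h2, h3, h4, h5, h6, h7, h8, h9, h10] at hgap hT hmd ⊢
  nlinarith [hgap, hT, hmd, hd3]

/-- `d + j = 4 + j′`, `j′ + 1 ≤ j`: `D − z` on the row `r′ = 4 + j′` of `k − 1` at its one-triangle gap. -/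
theorem rowT_del_up_T_four (j d j' k m' S' T : ℕ) (hs : d + j = 4 + j') (hj' : j' + 1 ≤ j) (hk : 12 + j ≤ k)
    (hmd : m' + d + (4 + j) = 4 * (k - 4))
    (hgap : S' + (4 + j') * (k - 1 - 1 - (4 + j')) + (2 * (k - 1) - 14 + 2 * j' * (4 - 3)) ≤ m' * (k - 1))
    (hT : T ≤ d * (k - 4 - 2)) :
    S' + 2 * T + d + d * d + (4 + j) * (k - 1 - (4 + j)) + (2 * k - 14 + 2 * j * (4 - 3)) ≤ (m' + d) * k := by
  obtain ⟨v, rfl⟩ : ∃ v, j = j' + 1 + v := ⟨j - (j' + 1), by omega⟩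
  have hd : d + v = 3 := by omega
  have h2 : 1 ≤ k := by omega
  have h3 : 1 ≤ k - 1 := by omega
  have h4 : 4 + j' ≤ k - 1 - 1 := by omega
  have h5 : 14 ≤ 2 * (k - 1) := by omega
  have h7 : 4 ≤ k := by omega
  have h8 : 2 ≤ k - 4 := by omega
  have h9 : 4 + (j' + 1 + v) ≤ k - 1 := by omega
  have h10 : 14 ≤ 2 * k := by omega
  zify [h2, h3, h4, h5, h7, h8, h9, h10] at hgap hT hmd hd ⊢
  nlinarith [hgap, hT, hmd, hd, Nat.zero_le (j' * v), Nat.zero_le (v * v)]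

/-- The all-off read on `(k, 4, 4 + j)`: `1 ≤ d ≤ 3`, the plain star bound of `D − z` and `T ≤ 4d`. -/
theorem rowT_alloff_arith_four (j d k m' S' T : ℕ) (hd1 : 1 ≤ d) (hda : d + 1 ≤ 4) (hk : 12 + j ≤ k)
    (hmd : m' + d + (4 + j) = 4 * (k - 4)) (hS' : S' + (d + j) * (k - 1 - 1 - (d + j)) ≤ m' * (k - 1))
    (hT : T ≤ d * 4) :
    S' + 2 * T + d + d * d + (4 + j) * (k - 1 - (4 + j)) + (2 * k - 14 + 2 * j * (4 - 3)) ≤ (m' + d) * k := by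
  have h2 : 1 ≤ k := by omega
  have h3 : 1 ≤ k - 1 := by omega
  have h4 : d + j ≤ k - 1 - 1 := by omega
  have h7 : 4 ≤ k := by omega
  have h9 : 4 + j ≤ k - 1 := by omega
  have h10 : 14 ≤ 2 * k := by omega
  zify [h2, h3, h4, h7, h9, h10] at hS' hT hmd ⊢
  nlinarith [hS', hT, hmd, hd1, hda]

/-- The crude mixed read at `d = 2` on `(k, 4, 4 + j)`: slack `2`. -/
theorem rowT_mixed_two_four (j k m' S' T : ℕ) (hk : 12 + j ≤ k)
    (hmd : m' + 2 + (4 + j) = 4 * (k - 4)) (hS' : S' + (2 + j) * (k - 1 - 1 - (2 + j)) ≤ m' * (k - 1))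
    (hT : T ≤ (k - 4 - 2) + 4) :
    S' + 2 * T + 2 + 2 * 2 + (4 + j) * (k - 1 - (4 + j)) + (2 * k - 14 + 2 * j * (4 - 3)) ≤ (m' + 2) * k := by
  have h2 : 1 ≤ k := by omega
  have h3 : 1 ≤ k - 1 := by omega
  have h4 : 2 + j ≤ k - 1 - 1 := by omega
  have h7 : 4 ≤ k := by omega
  have h8 : 2 ≤ k - 4 := by omega
  have h9 : 4 + j ≤ k - 1 := by omega
  have h10 : 14 ≤ 2 * k := by omega
  zify [h2, h3, h4, h7, h8, h9, h10] at hS' hT hmd ⊢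
  nlinarith [hS', hT, hmd]

end C047

end TriangleCap

end PercRepro
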